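import Summits.QuantumFields.YangMills.Theorems.BalabanUVNodesN22GenAnalyticReadingOfActivities
import Summits.QuantumFields.YangMills.Theorems.BalabanUVNodesN22W1StripLemma3

/-!
# BalabanUVNodes ∕ node N22 = NE9 — THE ANALYTIC READING TWO LAYERS DOWN: the (2.38)-type majorant of the read ACTIVITIES on the Banach ball (module J66's `hmaj`) from
# [II] (2.15)–(2.26) PER TERM (𝐃, P) read on the ball — Lemma 3's resummation BY NAME (torus socket `hRep_of_termwise` ∘ `h238_of_hRep_half` at the two-torus step whose
# configuration type IS the Banach parameter); hence ROAD 2 at the record with the older-term input at print's «by assertion» level (2.15)–(2.26), read on the ball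

Cell `pub-ymgap`, HUMAN RULING D-0062 (Track A), R134 seat `pub-ymgap-dag-n22-c` (strategy s1: «the history-Lipschitz estimate (2.40)–(2.41) p. 21 of [II] on the W1 object»), generation
18, module J67.  THEOREMS ONLY (no `def`, no `sorry`, standard axioms); `--kind proof --supports stmt-QuantumFields-27366 --as helper` (K3⁸ `SpineGivenEndpointR13SepCoPHV`), COUNT-NEUTRAL.
Imports module J66 `…N22GenAnalyticReadingOfActivities` and this lane's g2 module `…N22W1StripLemma3` (through it the Literature socket `B13Lemma3TorusSocket`: `HRep`, `Lemma3Numerics`,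
`hRep_of_termwise`, `h238_of_hRep_half`, and `B13Lemma3TorusTerms.terms ∕ weight`).  Nothing re-declared.

WHY (the g2–g5 endpoint, in the older-term currency).  Generations 2–5 of this lane ran the STRIP induction at the W1 object down to «print's by-assertion analytic content (2.15)–(2.26)
PER TERM, read on the strip of one young coupling» (`strip_succ_of_termwise226Strip`: the two-torus step with configuration type `Φ := ℂ`).  The same socket is CONFIGURATION-BLIND:
with `Φ := Pot k` — the Banach space into which the older-term families are read — and `sp2 Z := {p ∈ ball 0 R | Z ⊆ X}`, termwise domination `‖Ah k t φ Z p‖ ≤ Σ_{τ ∈ terms L M Z}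
‖Tt k t φ Z τ p‖` ((2.9)∕(2.14)) and (2.26) per term with the printed weight (`‖Tt … τ p‖ ≤ weight(τ)·e^{a₅|Z|}`) give `HRep` (`hRep_of_termwise`) and then (2.38) ON THE BALL
(`h238_of_hRep_half`, the socket's ONE numerics bundle `Lemma3Numerics c M (½L) …`, `L ≥ 8`): §1 ★★ `activityMajorant_of_termwise226Reading` — module J66's `hmaj` with `A_a = C₃ε₁`,
`R_a = (1−8δ)½Lκ`.  §2 ★★★ `ne9_EA_objectsOfRecord₁₃_of_kernelStepRate_termwise226ReadingNonexpansive` — K3's `h9` = J66 §2 with `hmaj` DISCHARGED (S25's two located clauses and the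
renewal now at `A := C₃ε₁`, `R := (1−8δ)½Lκ`, as in g2's `strip_succ_of_stripStepHRep`); §3 ★★★ socket `n22At_u3OfRecord₁₃_of_kernelStepRate_termwise226ReadingNonexpansive`.
After J67 the OLDER-TERM input of N22's ROAD 2 (recursion currency, non-expansive regime) is: a reading `ρA` of the older-term families into Banach spaces with its dominations; READ
ACTIVITIES `Ah` with (ARH-fact) and holomorphy on the ball; READ TERM VALUES `Tt` over print's term set dominating them and obeying **(2.26) per term on the ball** — [II] (2.15)–(2.26)
with the older terms COMPLEXIFIED through the reading (the cell's reading, NOT printed as such; print asserts (2.15)–(2.26) at the actual older terms) —; the margin clause; + N18,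
last-coupling sectors, (Adm-run), readings ∕ law ∕ (1.21), standing rows.

HONEST FRAMING (binding).  Count-neutral COMPOSITION of the tree's Lemma-3 torus socket (kernel theorems of [II] pp. 17–20) with module J66 BY NAME; the level-T data `Tt` and its two
inequalities are DISPLAYED HYPOTHESES (inhabited with `Ah ≡ 0`, `Tt ≡ 0` — A5, conditional content; `weight ≥ 0`); the numerics are the socket's printed restrictions + S25's located
O(1)'s; NO estimate of Bałaban's is asserted beyond the tree's kernel theorems used by name; nothing of the record is constructed or claimed to meet the displayed inputs.  N22 is NOT
discharged (typed 28∕28 · discharged 5∕27 UNCHANGED); K3⁸ OPEN and NOT claimed; NE9 is NOT IN PRINT for d = 4; no count claim; one finite 𝕋⁴ programme at fixed ε — R4 closes the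
CONDITIONAL rung `BalabanLadder.UV` only; NOTHING about the continuum limit, ℝ⁴, infinite volume, OS axioms, a mass gap or the Clay problem is proved or claimed.  References (TYPES
only): [II] = Bałaban, CMP 116 (1988) (2.9)–(2.15) pp. 14–15, (2.26) p. 17, pp. 17–20, (2.36) p. 19, Lemma 3 (2.38) p. 20, (2.39)–(2.41) p. 21; [I] = CMP 109 (1987) (0.23) p. 256, (1.18)
p. 263, (2.12)–(2.13) p. 268, §5 p. 298; Kotecký–Preiss, CMP 103 (1986) Thm p. 492; King, CMP 102 (1986) Lemma 4.5 (4.38).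
-/

noncomputable section

open Set Metric
open scoped BigOperators

namespace YMDAG.N22.TermRecursion

open Literature.MathematicalPhysics.QuantumFieldTheory.Balaban1983to89
open Literature.MathematicalPhysics.QuantumFieldTheory.Balaban1983to89.T4Continuum (T4Family)
open Literature.MathematicalPhysics.QuantumFieldTheory.Balaban1983to89.T4OutputRate (Window)
open Literature.MathematicalPhysics.QuantumFieldTheory.Balaban1983to89.TreeLengthTorus (TPt TDom tsys torusTreeLen torusTreeLen_nonneg)
open Literature.MathematicalPhysics.QuantumFieldTheory.Balaban1983to89.B12TreeDecay (K₀)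
open Literature.MathematicalPhysics.QuantumFieldTheory.Balaban1983to89.B13Lemma3TorusData (TBond)
open Literature.MathematicalPhysics.QuantumFieldTheory.Balaban1983to89.B13Lemma3Torus (TwoTorusStep)
open Literature.MathematicalPhysics.QuantumFieldTheory.Balaban1983to89.B13Lemma3TorusTerms (terms weight)
open Literature.MathematicalPhysics.QuantumFieldTheory.Balaban1983to89.B13Lemma3TorusSocket (HRep Lemma3Numerics h238_of_hRep_half hRep_of_termwise)
open Literature.MathematicalPhysics.QuantumFieldTheory.Balaban1983to89.Node00.Sect2 (domSys domCount CPair)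
open Literature.MathematicalPhysics.QuantumFieldTheory.Balaban1983to89.Node00.W1

/-! ## §1 (2.38) on the Banach ball from (2.26) per term — the torus socket at the step with configuration type `Pot k` -/
section Gen

variable (F : T4Family) {𝔸 : Type} {M : ℕ} [NeZero M] {K : ℕ}
  (sp : (k : ℕ) → (domSys (F.P K) M (k + 1)).Dom → Set (CPair (F.P K) 𝔸))
  {Pot : ℕ → Type} [∀ k, NormedAddCommGroup (Pot k)] [∀ k, NormedSpace ℂ (Pot k)]
  (Ah : (k : ℕ) → ℝ → CPair (F.P K) 𝔸 → (domSys (F.P K) M (k + 1)).Dom → Pot k → ℂ)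

omit [∀ k, NormedSpace ℂ (Pot k)] in
open Classical in
/-- ★★ **THE (2.38)-TYPE MAJORANT OF THE READ ACTIVITIES ON THE BANACH BALL FROM [II] (2.15)–(2.26) PER TERM, BY LEMMA 3's RESUMMATION (torus socket BY NAME).**  If on the
ball `ball 0 R` of the parameter space the read activities are dominated by read TERM VALUES indexed by print's term set, `‖Ah k t φ Z p‖ ≤ Σ_{τ ∈ terms L M Z} ‖Tt k t φ Z τ p‖`
((2.9)∕(2.14)), each obeying (2.26) p. 17 with the printed weight, `‖Tt k t φ Z τ p‖ ≤ weight(τ)·e^{a₅|Z|}`, then under the socket's numerics bundle `Lemma3Numerics c M (½L) …`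
(`L ≥ 8`): **`‖Ah k t φ Z p‖ ≤ C₃ε₁·e^{−(1−8δ)½Lκ·d_{k+1}(Z)}`** on the ball — the two-torus step with CONFIGURATION TYPE `Φ := Pot k` (the Banach parameter; all other fields
inert), `hRep_of_termwise` ∘ `h238_of_hRep_half` (this lane's g2 engine `strip_succ_of_termwise226Strip` with the strip parameter `z ∈ ℂ` replaced by `p ∈ Pot k`).  This is the
binder `hmaj` of module J66 with `A_a = C₃ε₁`, `R_a = (1−8δ)½Lκ`. [folklore] -/
theorem activityMajorant_of_termwise226Reading (c : B13.Consts) {L : ℕ} [NeZero L] (hL : 8 ≤ c.L) (hLc : c.L = L)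
    {a a₂ a₂' a₅ Aabs : ℝ} (hN : Lemma3Numerics c M ((c.L : ℝ) / 2) a a₂ a₂' a₅ Aabs) {γ R : ℝ}
    (Tt : (k : ℕ) → ℝ → CPair (F.P K) 𝔸 → (Z : TDom 4 (domCount (F.P K) M (k + 1))) →
      Finset (TDom 4 (L * domCount (F.P K) M (k + 1))) × Finset (TBond 4 M (L * domCount (F.P K) M (k + 1))) → Pot k → ℂ)
    (hdom : ∀ (k : ℕ), ∀ t ∈ Ioc (0 : ℝ) γ, ∀ (X : (domSys (F.P K) M (k + 1)).Dom), ∀ φ ∈ sp k X, ∀ (Z : (domSys (F.P K) M (k + 1)).Dom), Z.1 ⊆ X.1 →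
      ∀ p ∈ ball (0 : Pot k) R, ‖Ah k t φ Z p‖ ≤ ∑ τ ∈ terms L M Z, ‖Tt k t φ Z τ p‖)
    (h226 : ∀ (k : ℕ), ∀ t ∈ Ioc (0 : ℝ) γ, ∀ (X : (domSys (F.P K) M (k + 1)).Dom), ∀ φ ∈ sp k X, ∀ (Z : (domSys (F.P K) M (k + 1)).Dom), Z.1 ⊆ X.1 →
      ∀ p ∈ ball (0 : Pot k) R, ∀ τ ∈ terms L M Z, ‖Tt k t φ Z τ p‖ ≤ weight L M c Z a τ * Real.exp (a₅ * ((Z.1).card : ℝ))) :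
    ∀ (k : ℕ), ∀ t ∈ Ioc (0 : ℝ) γ, ∀ (X : (domSys (F.P K) M (k + 1)).Dom), ∀ φ ∈ sp k X, ∀ (Z : (domSys (F.P K) M (k + 1)).Dom), Z.1 ⊆ X.1 →
      ∀ p ∈ ball (0 : Pot k) R, ‖Ah k t φ Z p‖ ≤ c.C3act * c.ε₁ * Real.exp (-((1 - 8 * c.δ) * ((c.L : ℝ) / 2) * c.κ * torusTreeLen Z.1)) := by
  intro k t ht X φ hφ Z hZ p hp
  -- the two-torus step with configuration type the Banach parameter
  let W : TwoTorusStep 4 L (domCount (F.P K) M (k + 1)) :=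
    { volk := fun _ => 0, Φ := Pot k, Bond := PUnit, sp1 := fun _ => ∅, sp2 := fun Z => {p | p ∈ ball (0 : Pot k) R ∧ Z.1 ⊆ X.1},
      Bv := fun _ _ => 0, Vp := fun _ _ => 0, V := fun _ _ => 0, Q := fun _ _ _ _ => 0, Vpp := fun _ _ => 0,
      H := fun Z p => Ah k t φ Z p, Ek1 := fun _ _ => 0, Elog := fun _ _ => 0, Analytic := fun _ _ => True,
      GaugeInv := fun _ => True, Repr17 := True, Restr := True }
  have hrep : HRep c M a a₅ W :=
    hRep_of_termwise c (mul_nonneg hN.hα₆.le hN.hε₀) W (fun Z τ p => Tt k t φ Z τ p) (fun Z p hp => hdom k t ht X φ hφ Z hp.2 p hp.1)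
      (fun Z p hp τ hτ => h226 k t ht X φ hφ Z hp.2 p hp.1 τ hτ)
  have h238 := h238_of_hRep_half c hL hLc (N' := fun _ : ℕ => domCount (F.P K) M (k + 1)) (fun _ => W) M hN (fun _ => hrep) 0
  exact h238 Z p ⟨hp, hZ⟩

end Gen

end YMDAG.N22.TermRecursion

namespace YMDAG.N22.KernelFading

open Literature.MathematicalPhysics.QuantumFieldTheory.Balaban1983to89
open Literature.MathematicalPhysics.QuantumFieldTheory.Balaban1983to89.T4Continuum (T4Family ULoop)
open Literature.MathematicalPhysics.QuantumFieldTheory.Balaban1983to89.T4OutputRate (Window NE9)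
open Literature.MathematicalPhysics.QuantumFieldTheory.Balaban1983to89.TreeLengthTorus (TPt TDom tsys torusTreeLen)
open Literature.MathematicalPhysics.QuantumFieldTheory.Balaban1983to89.B12TreeDecay (K₀ kappa₀)
open Literature.MathematicalPhysics.QuantumFieldTheory.Balaban1983to89.B12Decay510 (delta1)
open Literature.MathematicalPhysics.QuantumFieldTheory.Balaban1983to89.B12Decay510Window (K₁)
open Literature.MathematicalPhysics.QuantumFieldTheory.Balaban1983to89.B12Decay510Torus (distCT nearT)
open Literature.MathematicalPhysics.QuantumFieldTheory.Balaban1983to89.B13Lemma3TorusData (TBond)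
open Literature.MathematicalPhysics.QuantumFieldTheory.Balaban1983to89.B13Lemma3TorusTerms (terms weight)
open Literature.MathematicalPhysics.QuantumFieldTheory.Balaban1983to89.B13Lemma3TorusSocket (Lemma3Numerics)
open Literature.MathematicalPhysics.QuantumFieldTheory.Balaban1983to89.Node00 (Stage13Params Stage13HParams U3Letters₁₁ MatA)
open Literature.MathematicalPhysics.QuantumFieldTheory.Balaban1983to89.Node00.Sect2 (domSys domCount CPair)
open Literature.MathematicalPhysics.QuantumFieldTheory.Balaban1983to89.Node00.W1
open Literature.MathematicalPhysics.QuantumFieldTheory.Balaban1983to89.Node00.LocalizedSum17 (ReadingMaps Localizes17OfRecord₁₃)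
open Literature.MathematicalPhysics.QuantumFieldTheory.Balaban1983to89.Node00.U3OfKernels (histPrefix objectsOfRecord₁₃)
open Literature.MathematicalPhysics.QuantumFieldTheory.Balaban1983to89.Node00.U3KernelLetters (KernelStepRateOfRecord₁₃ PolLimitsExistOfRecord₁₃)
open YMDAG.UVSplit (N22At u3OfRecord₁₃ RateReading₁₃CoPH rateCarriersOfRecord₁₃CoPH)
open YMDAG.N22.AtKernels (n22At_u3OfRecord₁₃_objectsOfRecord₁₃_iff)
open YMDAG.N22.TermRecursion (activityMajorant_of_termwise226Reading)

open scoped Matrix.Norms.L2Operator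

variable (F : T4Family) (N : ℕ) [NeZero N] {𝔸 : Type} {M : ℕ}

/-! ## §2 ★★★ K3's `h9` on ROAD 2 with the older-term input at (2.15)–(2.26) per term, read on the ball -/

open Classical Finset in
/-- ★★★ **K3's `h9` ON ROAD 2 FROM N18's KERNEL STEP RATE + [II] (2.15)–(2.26) PER TERM READ ON THE BANACH BALL OF OLDER-TERM FAMILIES — module J66 §2 with its (2.38)-type
majorant `hmaj` DISCHARGED by §1** (Lemma 3's resummation + Kotecký–Preiss holomorphy + (2.39)–(2.41), all BY NAME on the four-torus).  Inputs beyond J66's: the socket's numerics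
bundle `Lemma3Numerics c M (½L) …` (`L ≥ 8`), read TERM VALUES `Tt K k t φ Z τ p` over print's term set with termwise domination of the read activities and (2.26) per term on the
ball; S25's clauses and the renewal at `A := C₃ε₁`, `R := (1−8δ)½Lκ` (`r₁ + 2·64·log 162 + 2 ≤ R`, `C₃ε₁e^{5r₁+1}K₀(64,8)·9·64 ≤ 1`, `κ_E ≤ r₁`, `e·9·64·K₀(64,8)²C₃ε₁ ≤ M_b`)
⟹ **`NE9 ((objectsOfRecord₁₃ F N θ ℓ).EA 0) (Window θ.γ) ℓ.κ ℓ.moduli`**.  LOCATED (hypothesis form: (2.15)–(2.26) read on the ball = the cell's complexification of print's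
by-assertion content through the older terms; GAPS G-ne9p2-5 at the term-data level); N22 NOT discharged. [folklore] -/
theorem ne9_EA_objectsOfRecord₁₃_of_kernelStepRate_termwise226ReadingNonexpansive (θ : Stage13Params F N) (ℓ : U3Letters₁₁) (hs : ℓ.Signs) (hγ : 0 < θ.γ)
    (hlim : PolLimitsExistOfRecord₁₃ F N θ) {κ₅ C₅ : ℝ} (hC₅ : 0 ≤ C₅) (h5 : KernelStepRateOfRecord₁₃ F N θ κ₅ ℓ.θ₅ C₅)
    (m' : ℕ) (M : ℕ) [NeZero M] (hM : M = F.L ^ m')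
    (Gn : (K : ℕ) → GenTower (F.P K) 𝔸 M) (emb : ReadingMaps F (MatA N) 𝔸)
    (hloc : Localizes17OfRecord₁₃ F N θ (fun K => truncRun K (toClusterTower (Gn K))) emb)
    (sp : (K k : ℕ) → (domSys (F.P K) M (k + 1)).Dom → Set (CPair (F.P K) 𝔸))
    {κ κE δ₀ B₃ r R r₀ ϱ Mb cw cS Bq r₁ : ℝ} {aw : ℕ → ℕ → ℕ → ℝ}
    (hκ₀ : kappa₀ (4 * 2 ^ 4) (2 * 4) ≤ κ / 2) (hδ₀ : 0 < δ₀) (hB₃ : 0 ≤ B₃) (hr : 0 < r) (hκE : κ ≤ κE)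
    (Adm : (K k : ℕ) → OlderTerms (F.P K) 𝔸 M k → Prop)
    (hAdm : ∀ K, ∀ g ∈ Window θ.γ, ∀ k, Adm K k (olderOf (recTerm (Gn K) fun n => ((g n : ℝ) : ℂ)) k))
    {Pot : ℕ → ℕ → Type} [∀ K k, NormedAddCommGroup (Pot K k)] [∀ K k, NormedSpace ℂ (Pot K k)]
    (ρA : (K k : ℕ) → OlderTerms (F.P K) 𝔸 M k → Pot K k) (Ah : (K k : ℕ) → ℝ → CPair (F.P K) 𝔸 → (domSys (F.P K) M (k + 1)).Dom → Pot K k → ℂ)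
    (hHA : ∀ (K k : ℕ), ∀ t ∈ Ioc (0 : ℝ) θ.γ, ∀ (old : OlderTerms (F.P K) 𝔸 M k), Adm K k old → ∀ (X : (domSys (F.P K) M (k + 1)).Dom), ∀ φ ∈ sp K k X,
      ∀ (Z : (domSys (F.P K) M (k + 1)).Dom), Z.1 ⊆ X.1 → ((Gn K) k).H ((t : ℝ) : ℂ) old φ Z = Ah K k t φ Z (ρA K k old))
    (hAh : ∀ (K k : ℕ), ∀ t ∈ Ioc (0 : ℝ) θ.γ, ∀ (X : (domSys (F.P K) M (k + 1)).Dom), ∀ φ ∈ sp K k X, ∀ (Z : (domSys (F.P K) M (k + 1)).Dom), Z.1 ⊆ X.1 →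
      DifferentiableOn ℂ (Ah K k t φ Z) (ball 0 R))
    (c : B13.Consts) {L : ℕ} [NeZero L] (hL : 8 ≤ c.L) (hLc : c.L = L) {a a₂ a₂' a₅ Aabs : ℝ} (hN : Lemma3Numerics c M ((c.L : ℝ) / 2) a a₂ a₂' a₅ Aabs)
    (Tt : (K k : ℕ) → ℝ → CPair (F.P K) 𝔸 → (Z : TDom 4 (domCount (F.P K) M (k + 1))) →
      Finset (TDom 4 (L * domCount (F.P K) M (k + 1))) × Finset (TBond 4 M (L * domCount (F.P K) M (k + 1))) → Pot K k → ℂ)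
    (hdom : ∀ (K k : ℕ), ∀ t ∈ Ioc (0 : ℝ) θ.γ, ∀ (X : (domSys (F.P K) M (k + 1)).Dom), ∀ φ ∈ sp K k X, ∀ (Z : (domSys (F.P K) M (k + 1)).Dom), Z.1 ⊆ X.1 →
      ∀ p ∈ ball (0 : Pot K k) R, ‖Ah K k t φ Z p‖ ≤ ∑ τ ∈ terms L M Z, ‖Tt K k t φ Z τ p‖)
    (h226 : ∀ (K k : ℕ), ∀ t ∈ Ioc (0 : ℝ) θ.γ, ∀ (X : (domSys (F.P K) M (k + 1)).Dom), ∀ φ ∈ sp K k X, ∀ (Z : (domSys (F.P K) M (k + 1)).Dom), Z.1 ⊆ X.1 →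
      ∀ p ∈ ball (0 : Pot K k) R, ∀ τ ∈ terms L M Z, ‖Tt K k t φ Z τ p‖ ≤ weight L M c Z a τ * Real.exp (a₅ * ((Z.1).card : ℝ)))
    (hA0 : 0 ≤ c.C3act * c.ε₁) (hr₁ : 0 ≤ r₁) (hrate : r₁ + 2 * (64 * Real.log 162) + 2 ≤ (1 - 8 * c.δ) * ((c.L : ℝ) / 2) * c.κ)
    (hsmall : c.C3act * c.ε₁ * Real.exp (5 * r₁ + 1) * K₀ 64 8 * 9 * 64 ≤ 1) (hκr : κE ≤ r₁) (hrenew : Real.exp 1 * 9 * 64 * K₀ 64 8 ^ 2 * (c.C3act * c.ε₁) ≤ Mb)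
    (hAdmr : ∀ (K k : ℕ) (old : OlderTerms (F.P K) 𝔸 M k), Adm K k old → ‖ρA K k old‖ ≤ r₀)
    (hρ₁ : ∀ (K k : ℕ) (o o' : OlderTerms (F.P K) 𝔸 M k), Adm K k o → Adm K k o' → ∀ (B' : ℝ), 0 ≤ B' →
      (∀ (k' : ℕ) (hk' : k' < k) (Y : (domSys (F.P K) M (k' + 1)).Dom), ∀ φ' ∈ sp K k' Y,
        aw K k (k' + 1) * (Real.exp (κE * (domSys (F.P K) M (k' + 1)).dj Y) * ‖o ⟨k' + 1, Nat.succ_lt_succ hk'⟩ Y φ' - o' ⟨k' + 1, Nat.succ_lt_succ hk'⟩ Y φ'‖) ≤ B') →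
      ‖ρA K k o - ρA K k o'‖ ≤ B')
    (hρ₂ : ∀ (K k : ℕ) (o₁ o₂ o₃ : OlderTerms (F.P K) 𝔸 M k), Adm K k o₁ → Adm K k o₂ → Adm K k o₃ → ∀ (B' : ℝ), 0 ≤ B' →
      (∀ (k' : ℕ) (hk' : k' < k) (Y : (domSys (F.P K) M (k' + 1)).Dom), ∀ φ' ∈ sp K k' Y,
        aw K k (k' + 1) * (Real.exp (κE * (domSys (F.P K) M (k' + 1)).dj Y) *
          ‖o₁ ⟨k' + 1, Nat.succ_lt_succ hk'⟩ Y φ' - 2 * o₂ ⟨k' + 1, Nat.succ_lt_succ hk'⟩ Y φ' + o₃ ⟨k' + 1, Nat.succ_lt_succ hk'⟩ Y φ'‖) ≤ B') →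
      ‖ρA K k o₁ - (2 : ℂ) • ρA K k o₂ + ρA K k o₃‖ ≤ B')
    (haw : ∀ K k j, 0 ≤ aw K k j) (hawcw : ∀ K k j, aw K k j ≤ cw) (hC1 : 4 * Mb * cw / ϱ < 1)
    (hMb0 : 0 ≤ Mb) (hϱ : 0 < ϱ) (hR : r₀ + ϱ < R)
    (O : ℕ → Set ℂ) (V : (K k : ℕ) → OlderTerms (F.P K) 𝔸 M k → CPair (F.P K) 𝔸 → (domSys (F.P K) M (k + 1)).Dom → ℂ) (hcS : 0 < cS) (hBq : 0 ≤ Bq)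
    (hballS : ∀ K, ∀ s ∈ Ioc (0 : ℝ) θ.γ, closedBall (s : ℂ) (cS * s) ⊆ O K)
    (hholS : ∀ (K k : ℕ) (old : OlderTerms (F.P K) 𝔸 M k), Adm K k old → ∀ (X : (domSys (F.P K) M (k + 1)).Dom), ∀ φ ∈ sp K k X,
      DifferentiableOn ℂ (fun z => ((Gn K) k).E z old φ X) (O K))
    (hbdS : ∀ (K k : ℕ) (old : OlderTerms (F.P K) 𝔸 M k), Adm K k old → ∀ (X : (domSys (F.P K) M (k + 1)).Dom), ∀ φ ∈ sp K k X, ∀ s ∈ Ioc (0 : ℝ) θ.γ,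
      ∀ z ∈ closedBall (s : ℂ) (cS * s), ‖((Gn K) k).E z old φ X - V K k old φ X‖ ≤ Bq * Real.exp (-(κE * (domSys (F.P K) M (k + 1)).dj X)) * s ^ 2)
    (Ec : ℕ → ℕ → Type*) [∀ K k, NormedAddCommGroup (Ec K k)] [∀ K k, NormedSpace ℂ (Ec K k)]
    (ι : letI := θ.instVβ₁; letI := θ.instVβ₂
      (K k : ℕ) → (domSys (F.P K) M (k + 1)).Dom → ((Fin (F.P K).d → Site (F.P K) (k + 1) → θ.Vβ) →L[ℝ] Ec K k))
    (Φ : (K k : ℕ) → (domSys (F.P K) M (k + 1)).Dom → Ec K k → CPair (F.P K) 𝔸)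
    (U : (K k : ℕ) → (domSys (F.P K) M (k + 1)).Dom → Set (Ec K k)) (hU : ∀ K k X, IsOpen (U K k X)) (hrU : ∀ K k X, ball (0 : Ec K k) r ⊆ U K k X)
    (hEhol : ∀ g ∈ Window θ.γ, ∀ (K k : ℕ) (X : (domSys (F.P K) M (k + 1)).Dom),
      DifferentiableOn ℂ (fun z => (truncRun K (toClusterTower (Gn K)) k).E (histPrefix g k) (Φ K k X z) X) (U K k X))
    (hΦemb : letI := θ.instVβ₁; letI := θ.instVβ₂
      ∀ (K k : ℕ) (X : (domSys (F.P K) M (k + 1)).Dom) (Bf : Fin (F.P K).d → Site (F.P K) (k + 1) → θ.Vβ),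
        Φ K k X (ι K k X Bf) = emb K k (fun l t => NormedSpace.exp (θ.ρ8 (Bf l t))))
    (hΦsp : ∀ (K k : ℕ) (X : (domSys (F.P K) M (k + 1)).Dom), ∀ z ∈ ball (0 : Ec K k) r, Φ K k X z ∈ sp K k X)
    (w : (K k : ℕ) → (domSys (F.P K) M (k + 1)).Dom → Site (F.P K) (k + 1) → ℝ) (hw₀ : ∀ K k X t, 0 ≤ w K k X t)
    (hw : letI := θ.instVβ₁; letI := θ.instVβ₂; letI := θ.instιβ
      ∀ (K k : ℕ) (X : (domSys (F.P K) M (k + 1)).Dom) (l : Fin (F.P K).d) (t : Site (F.P K) (k + 1)) (c : θ.ιβ),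
        ‖ι K k X (Pi.single l (Pi.single t (θ.bV c)))‖ ≤ w K k X t)
    (htail : ∀ (K k : ℕ) (X : (domSys (F.P K) M (k + 1)).Dom) (t : Site (F.P K) (k + 1)),
      let e : Site (F.P K) (k + 1) → TPt 4 (domCount (F.P K) M (k + 1) * M) := fun x i => (ZMod.cast (x i) : ZMod (domCount (F.P K) M (k + 1) * M))
      w K k X t ≤ B₃ * Real.exp (-δ₀ * distCT (domCount (F.P K) M (k + 1)) M (e t) (nearT (M := M) (e t) X)))
    (hκ₅ : delta1 δ₀ κ ((M : ℝ) * 4) ≤ κ₅)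
    (hω : 0 < ℓ.ω) (hθω : ℓ.θ₅ ≤ ℓ.ω ^ 2) (hℓκ : ℓ.κ ≤ delta1 δ₀ κ ((M : ℝ) * 4))
    (hC₉ : (4 * (2 * C₅ / (1 - ℓ.θ₅) + 2 * ((16 * Mb * B₃ ^ 2 / r ^ 2) * Real.exp (delta1 δ₀ κ ((M : ℝ) * 4) * ((M : ℝ) * 4) * 3) * K₀ (4 * 2 ^ 4) (2 * 4) * K₁ 4 (δ₀ / 2))) / θ.γ +
        ((16 * max ((6 * cS ^ 2 + 32 * cS + 64) / cS ^ 2 * Bq) (64 * Mb * cw ^ 2 / ϱ ^ 2 * (Bq * θ.γ / cS) ^ 2 / (1 - 4 * Mb * cw / ϱ)) * B₃ ^ 2 / r ^ 2) * Real.exp (delta1 δ₀ κ ((M : ℝ) * 4) * ((M : ℝ) * 4) * 3) * K₀ (4 * 2 ^ 4) (2 * 4) *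
          K₁ 4 (δ₀ / 2)) * θ.γ / 2) / ℓ.ω ≤ ℓ.C₉) :
    NE9 ((objectsOfRecord₁₃ F N θ ℓ).EA 0) (Window θ.γ) ℓ.κ ℓ.moduli :=
  ne9_EA_objectsOfRecord₁₃_of_kernelStepRate_activityReadingNonexpansive F N θ ℓ hs hγ hlim hC₅ h5 m' M hM Gn emb hloc sp hκ₀ hδ₀ hB₃ hr hκE Adm hAdm ρA Ah hHA hAh
      (fun K => activityMajorant_of_termwise226Reading F (sp K) (Ah K) c hL hLc hN (Tt K) (hdom K) (h226 K)) hA0 hr₁ hrate hsmall hκr hrenew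
      hAdmr hρ₁ hρ₂ haw hawcw hC1 hMb0 hϱ hR O V hcS hBq hballS hholS hbdS Ec ι Φ U hU hrU hEhol hΦemb hΦsp w hw₀ hw htail hκ₅ hω hθω hℓκ hC₉

/-! ## §3 ★★★ The kernel-face socket -/

open Classical Finset in
/-- ★★★ **THE KERNEL-FACE SOCKET WITH THE OLDER-TERM INPUT AT (2.15)–(2.26) PER TERM ON THE BALL** — §2's inputs ⟹ **`N22At (u3OfRecord₁₃ θ (objectsOfRecord₁₃ F N θ ℓ) k)` for
EVERY run length `k`** (dag-n27-c's `h22` row).  LOCATED (hypothesis form); N22 NOT discharged. [folklore] -/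
theorem n22At_u3OfRecord₁₃_of_kernelStepRate_termwise226ReadingNonexpansive (θ : Stage13Params F N) (ℓ : U3Letters₁₁) (hs : ℓ.Signs) (hγ : 0 < θ.γ)
    (hlim : PolLimitsExistOfRecord₁₃ F N θ) {κ₅ C₅ : ℝ} (hC₅ : 0 ≤ C₅) (h5 : KernelStepRateOfRecord₁₃ F N θ κ₅ ℓ.θ₅ C₅)
    (m' : ℕ) (M : ℕ) [NeZero M] (hM : M = F.L ^ m')
    (Gn : (K : ℕ) → GenTower (F.P K) 𝔸 M) (emb : ReadingMaps F (MatA N) 𝔸)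
    (hloc : Localizes17OfRecord₁₃ F N θ (fun K => truncRun K (toClusterTower (Gn K))) emb)
    (sp : (K k : ℕ) → (domSys (F.P K) M (k + 1)).Dom → Set (CPair (F.P K) 𝔸))
    {κ κE δ₀ B₃ r R r₀ ϱ Mb cw cS Bq r₁ : ℝ} {aw : ℕ → ℕ → ℕ → ℝ}
    (hκ₀ : kappa₀ (4 * 2 ^ 4) (2 * 4) ≤ κ / 2) (hδ₀ : 0 < δ₀) (hB₃ : 0 ≤ B₃) (hr : 0 < r) (hκE : κ ≤ κE)
    (Adm : (K k : ℕ) → OlderTerms (F.P K) 𝔸 M k → Prop)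
    (hAdm : ∀ K, ∀ g ∈ Window θ.γ, ∀ k, Adm K k (olderOf (recTerm (Gn K) fun n => ((g n : ℝ) : ℂ)) k))
    {Pot : ℕ → ℕ → Type} [∀ K k, NormedAddCommGroup (Pot K k)] [∀ K k, NormedSpace ℂ (Pot K k)]
    (ρA : (K k : ℕ) → OlderTerms (F.P K) 𝔸 M k → Pot K k) (Ah : (K k : ℕ) → ℝ → CPair (F.P K) 𝔸 → (domSys (F.P K) M (k + 1)).Dom → Pot K k → ℂ)
    (hHA : ∀ (K k : ℕ), ∀ t ∈ Ioc (0 : ℝ) θ.γ, ∀ (old : OlderTerms (F.P K) 𝔸 M k), Adm K k old → ∀ (X : (domSys (F.P K) M (k + 1)).Dom), ∀ φ ∈ sp K k X,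
      ∀ (Z : (domSys (F.P K) M (k + 1)).Dom), Z.1 ⊆ X.1 → ((Gn K) k).H ((t : ℝ) : ℂ) old φ Z = Ah K k t φ Z (ρA K k old))
    (hAh : ∀ (K k : ℕ), ∀ t ∈ Ioc (0 : ℝ) θ.γ, ∀ (X : (domSys (F.P K) M (k + 1)).Dom), ∀ φ ∈ sp K k X, ∀ (Z : (domSys (F.P K) M (k + 1)).Dom), Z.1 ⊆ X.1 →
      DifferentiableOn ℂ (Ah K k t φ Z) (ball 0 R))
    (c : B13.Consts) {L : ℕ} [NeZero L] (hL : 8 ≤ c.L) (hLc : c.L = L) {a a₂ a₂' a₅ Aabs : ℝ} (hN : Lemma3Numerics c M ((c.L : ℝ) / 2) a a₂ a₂' a₅ Aabs)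
    (Tt : (K k : ℕ) → ℝ → CPair (F.P K) 𝔸 → (Z : TDom 4 (domCount (F.P K) M (k + 1))) →
      Finset (TDom 4 (L * domCount (F.P K) M (k + 1))) × Finset (TBond 4 M (L * domCount (F.P K) M (k + 1))) → Pot K k → ℂ)
    (hdom : ∀ (K k : ℕ), ∀ t ∈ Ioc (0 : ℝ) θ.γ, ∀ (X : (domSys (F.P K) M (k + 1)).Dom), ∀ φ ∈ sp K k X, ∀ (Z : (domSys (F.P K) M (k + 1)).Dom), Z.1 ⊆ X.1 →
      ∀ p ∈ ball (0 : Pot K k) R, ‖Ah K k t φ Z p‖ ≤ ∑ τ ∈ terms L M Z, ‖Tt K k t φ Z τ p‖)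
    (h226 : ∀ (K k : ℕ), ∀ t ∈ Ioc (0 : ℝ) θ.γ, ∀ (X : (domSys (F.P K) M (k + 1)).Dom), ∀ φ ∈ sp K k X, ∀ (Z : (domSys (F.P K) M (k + 1)).Dom), Z.1 ⊆ X.1 →
      ∀ p ∈ ball (0 : Pot K k) R, ∀ τ ∈ terms L M Z, ‖Tt K k t φ Z τ p‖ ≤ weight L M c Z a τ * Real.exp (a₅ * ((Z.1).card : ℝ)))
    (hA0 : 0 ≤ c.C3act * c.ε₁) (hr₁ : 0 ≤ r₁) (hrate : r₁ + 2 * (64 * Real.log 162) + 2 ≤ (1 - 8 * c.δ) * ((c.L : ℝ) / 2) * c.κ)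
    (hsmall : c.C3act * c.ε₁ * Real.exp (5 * r₁ + 1) * K₀ 64 8 * 9 * 64 ≤ 1) (hκr : κE ≤ r₁) (hrenew : Real.exp 1 * 9 * 64 * K₀ 64 8 ^ 2 * (c.C3act * c.ε₁) ≤ Mb)
    (hAdmr : ∀ (K k : ℕ) (old : OlderTerms (F.P K) 𝔸 M k), Adm K k old → ‖ρA K k old‖ ≤ r₀)
    (hρ₁ : ∀ (K k : ℕ) (o o' : OlderTerms (F.P K) 𝔸 M k), Adm K k o → Adm K k o' → ∀ (B' : ℝ), 0 ≤ B' →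
      (∀ (k' : ℕ) (hk' : k' < k) (Y : (domSys (F.P K) M (k' + 1)).Dom), ∀ φ' ∈ sp K k' Y,
        aw K k (k' + 1) * (Real.exp (κE * (domSys (F.P K) M (k' + 1)).dj Y) * ‖o ⟨k' + 1, Nat.succ_lt_succ hk'⟩ Y φ' - o' ⟨k' + 1, Nat.succ_lt_succ hk'⟩ Y φ'‖) ≤ B') →
      ‖ρA K k o - ρA K k o'‖ ≤ B')
    (hρ₂ : ∀ (K k : ℕ) (o₁ o₂ o₃ : OlderTerms (F.P K) 𝔸 M k), Adm K k o₁ → Adm K k o₂ → Adm K k o₃ → ∀ (B' : ℝ), 0 ≤ B' →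
      (∀ (k' : ℕ) (hk' : k' < k) (Y : (domSys (F.P K) M (k' + 1)).Dom), ∀ φ' ∈ sp K k' Y,
        aw K k (k' + 1) * (Real.exp (κE * (domSys (F.P K) M (k' + 1)).dj Y) *
          ‖o₁ ⟨k' + 1, Nat.succ_lt_succ hk'⟩ Y φ' - 2 * o₂ ⟨k' + 1, Nat.succ_lt_succ hk'⟩ Y φ' + o₃ ⟨k' + 1, Nat.succ_lt_succ hk'⟩ Y φ'‖) ≤ B') →
      ‖ρA K k o₁ - (2 : ℂ) • ρA K k o₂ + ρA K k o₃‖ ≤ B')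
    (haw : ∀ K k j, 0 ≤ aw K k j) (hawcw : ∀ K k j, aw K k j ≤ cw) (hC1 : 4 * Mb * cw / ϱ < 1)
    (hMb0 : 0 ≤ Mb) (hϱ : 0 < ϱ) (hR : r₀ + ϱ < R)
    (O : ℕ → Set ℂ) (V : (K k : ℕ) → OlderTerms (F.P K) 𝔸 M k → CPair (F.P K) 𝔸 → (domSys (F.P K) M (k + 1)).Dom → ℂ) (hcS : 0 < cS) (hBq : 0 ≤ Bq)
    (hballS : ∀ K, ∀ s ∈ Ioc (0 : ℝ) θ.γ, closedBall (s : ℂ) (cS * s) ⊆ O K)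
    (hholS : ∀ (K k : ℕ) (old : OlderTerms (F.P K) 𝔸 M k), Adm K k old → ∀ (X : (domSys (F.P K) M (k + 1)).Dom), ∀ φ ∈ sp K k X,
      DifferentiableOn ℂ (fun z => ((Gn K) k).E z old φ X) (O K))
    (hbdS : ∀ (K k : ℕ) (old : OlderTerms (F.P K) 𝔸 M k), Adm K k old → ∀ (X : (domSys (F.P K) M (k + 1)).Dom), ∀ φ ∈ sp K k X, ∀ s ∈ Ioc (0 : ℝ) θ.γ,
      ∀ z ∈ closedBall (s : ℂ) (cS * s), ‖((Gn K) k).E z old φ X - V K k old φ X‖ ≤ Bq * Real.exp (-(κE * (domSys (F.P K) M (k + 1)).dj X)) * s ^ 2)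
    (Ec : ℕ → ℕ → Type*) [∀ K k, NormedAddCommGroup (Ec K k)] [∀ K k, NormedSpace ℂ (Ec K k)]
    (ι : letI := θ.instVβ₁; letI := θ.instVβ₂
      (K k : ℕ) → (domSys (F.P K) M (k + 1)).Dom → ((Fin (F.P K).d → Site (F.P K) (k + 1) → θ.Vβ) →L[ℝ] Ec K k))
    (Φ : (K k : ℕ) → (domSys (F.P K) M (k + 1)).Dom → Ec K k → CPair (F.P K) 𝔸)
    (U : (K k : ℕ) → (domSys (F.P K) M (k + 1)).Dom → Set (Ec K k)) (hU : ∀ K k X, IsOpen (U K k X)) (hrU : ∀ K k X, ball (0 : Ec K k) r ⊆ U K k X)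
    (hEhol : ∀ g ∈ Window θ.γ, ∀ (K k : ℕ) (X : (domSys (F.P K) M (k + 1)).Dom),
      DifferentiableOn ℂ (fun z => (truncRun K (toClusterTower (Gn K)) k).E (histPrefix g k) (Φ K k X z) X) (U K k X))
    (hΦemb : letI := θ.instVβ₁; letI := θ.instVβ₂
      ∀ (K k : ℕ) (X : (domSys (F.P K) M (k + 1)).Dom) (Bf : Fin (F.P K).d → Site (F.P K) (k + 1) → θ.Vβ),
        Φ K k X (ι K k X Bf) = emb K k (fun l t => NormedSpace.exp (θ.ρ8 (Bf l t))))
    (hΦsp : ∀ (K k : ℕ) (X : (domSys (F.P K) M (k + 1)).Dom), ∀ z ∈ ball (0 : Ec K k) r, Φ K k X z ∈ sp K k X)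
    (w : (K k : ℕ) → (domSys (F.P K) M (k + 1)).Dom → Site (F.P K) (k + 1) → ℝ) (hw₀ : ∀ K k X t, 0 ≤ w K k X t)
    (hw : letI := θ.instVβ₁; letI := θ.instVβ₂; letI := θ.instιβ
      ∀ (K k : ℕ) (X : (domSys (F.P K) M (k + 1)).Dom) (l : Fin (F.P K).d) (t : Site (F.P K) (k + 1)) (c : θ.ιβ),
        ‖ι K k X (Pi.single l (Pi.single t (θ.bV c)))‖ ≤ w K k X t)
    (htail : ∀ (K k : ℕ) (X : (domSys (F.P K) M (k + 1)).Dom) (t : Site (F.P K) (k + 1)),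
      let e : Site (F.P K) (k + 1) → TPt 4 (domCount (F.P K) M (k + 1) * M) := fun x i => (ZMod.cast (x i) : ZMod (domCount (F.P K) M (k + 1) * M))
      w K k X t ≤ B₃ * Real.exp (-δ₀ * distCT (domCount (F.P K) M (k + 1)) M (e t) (nearT (M := M) (e t) X)))
    (hκ₅ : delta1 δ₀ κ ((M : ℝ) * 4) ≤ κ₅)
    (hω : 0 < ℓ.ω) (hθω : ℓ.θ₅ ≤ ℓ.ω ^ 2) (hℓκ : ℓ.κ ≤ delta1 δ₀ κ ((M : ℝ) * 4))
    (hC₉ : (4 * (2 * C₅ / (1 - ℓ.θ₅) + 2 * ((16 * Mb * B₃ ^ 2 / r ^ 2) * Real.exp (delta1 δ₀ κ ((M : ℝ) * 4) * ((M : ℝ) * 4) * 3) * K₀ (4 * 2 ^ 4) (2 * 4) * K₁ 4 (δ₀ / 2))) / θ.γ +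
        ((16 * max ((6 * cS ^ 2 + 32 * cS + 64) / cS ^ 2 * Bq) (64 * Mb * cw ^ 2 / ϱ ^ 2 * (Bq * θ.γ / cS) ^ 2 / (1 - 4 * Mb * cw / ϱ)) * B₃ ^ 2 / r ^ 2) * Real.exp (delta1 δ₀ κ ((M : ℝ) * 4) * ((M : ℝ) * 4) * 3) * K₀ (4 * 2 ^ 4) (2 * 4) *
          K₁ 4 (δ₀ / 2)) * θ.γ / 2) / ℓ.ω ≤ ℓ.C₉) (k : ℕ) :
    N22At (u3OfRecord₁₃ θ (objectsOfRecord₁₃ F N θ ℓ) k) :=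
  (n22At_u3OfRecord₁₃_objectsOfRecord₁₃_iff F N θ ℓ hs k).2
    (ne9_EA_objectsOfRecord₁₃_of_kernelStepRate_activityReadingNonexpansive F N θ ℓ hs hγ hlim hC₅ h5 m' M hM Gn emb hloc sp hκ₀ hδ₀ hB₃ hr hκE Adm hAdm ρA Ah hHA hAh
      (fun K => activityMajorant_of_termwise226Reading F (sp K) (Ah K) c hL hLc hN (Tt K) (hdom K) (h226 K)) hA0 hr₁ hrate hsmall hκr hrenew
      hAdmr hρ₁ hρ₂ haw hawcw hC1 hMb0 hϱ hR O V hcS hBq hballS hholS hbdS Ec ι Φ U hU hrU hEhol hΦemb hΦsp w hw₀ hw htail hκ₅ hω hθω hℓκ hC₉)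

end YMDAG.N22.KernelFading

end
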